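import Literature.Geometry.Manifold.DeRhamLocalToSubset
import Literature.AlgebraicTopology.SingularHomology.SubsetCochainsEmbedding
import Literature.AlgebraicTopology.SingularHomology.SubsetCochainsComparisonPull
import Literature.AlgebraicTopology.SingularHomology.CechTautness
import Literature.AlgebraicTopology.Homotopy.ENRTheorem
import Literature.AlgebraicTopology.Homotopy.NeighbourhoodRetract
import Literature.Geometry.Manifold.TopologicalEmbedding
import HarnessLib

/-!
# Tautness of an embedded compact manifold for de Rham forms on neighbourhoods

Topic `Literature/Geometry/Manifold`. Let `M` be a compact Hausdorff `C^∞` manifold (second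
countable, finite-dimensional real model) and `f : P → M` a `C^∞` map from a compact manifold `P`
which is a topological embedding, `K = f(P)`. The two classical consequences of the **tautness**
of the compact, locally contractible subset `K ⊆ M` (E. H. Spanier, *Algebraic Topology* (1966),
Ch. 6 §1, Thm. 10; the tree's `Cech.RetractionNhds`, proved from Hatcher's Thm. A.7) for DE RHAM
forms on open neighbourhoods of `K`, through the tree's de Rham comparison of open subsets valued
in the cohomology of subsets (`Literature.Geometry.Manifold.localDeRhamToSubset`, Bredon (1993),
Thm. V.9.5, bijective and natural for restrictions and for `C^∞` maps into an open set):

* `exists_nhd_homologyMap_res_eq_zero_of_pullback` (**T1**): a de Rham class on an open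
  `W ⊇ K` whose pull-back along `f` vanishes on `P` already vanishes on some open `V` with
  `K ⊆ V ⊆ W`; element forms `exists_nhd_restr_mem_localExactForms_of_pullback_eq_mextDeriv`
  (positive degree: a closed form on `W` whose pull-back is exact is exact near `K`) and
  `exists_nhd_restr_eq_zero_of_pullback_eq_zero` (degree `0`);
* `exists_nhd_homologyMap_pullbackInto_eq` (**T2**): every de Rham class of `P` is the pull-back of
  a class on an open `V`, `K ⊆ V ⊆ W`, for any given open `W ⊇ K`; element form
  `exists_nhd_pullback_sub_mem_exact` (a closed form on `P` is, up to an exact form, the pull-back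
  of a closed form on a neighbourhood of `K`).

Ingredients, all in the tree: `Cech.RetractionNhds.nonempty_of_locallyContractibleSpace` (with
`exists_isClosedEmbedding_pi_of_compactSpace`, `isNeighbourhoodRetract_range_of_compactSpace`,
`locallyContractibleSpace_of_chartedSpace`), `Cech.RetractionNhds.injective_toSubset` /
`surjective_toSubset`, `Cech.of_eq_zero_iff`, `subsetCochains.pullH_bijective_iff`,
`subsetCochains.resH_comp_pullH`, `localDeRhamToSubset_bijective`, `localDeRhamToSubset_res_apply`,
`localDeRhamToSubset_pullbackInto_apply`. Real coefficients. Everything is proved; no named facts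
(D-0026). This is brick [C₁] of the direct route to Deligne's Hodge III, Cor. 8.2.8 on the tree's
compact Kähler carriers (`Literature/AlgebraicGeometry/HodgeTheory/GysinKernelSplitRationalCore.lean`).

## References

* E. H. Spanier, *Algebraic Topology*, Springer 1981, Ch. 6 §1, Thm. 10. [Spanier1981]
* G. E. Bredon, *Topology and Geometry*, GTM 139 (1993), Thm. V.9.5. [Bredon1993]
* A. Hatcher, *Algebraic Topology* (2002), Thm. A.7, Cor. A.9. [HatcherAT2002]
-/

noncomputable section

-- see "Implementation notes" in `…SingularHomology.SingularChainsConcrete`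
set_option backward.isDefEq.respectTransparency false

open scoped Manifold ContDiff Topology
open CategoryTheory Limits Set Literature.AlgebraicTopology.SingularHomology Literature.Geometry.Kaehler
open _root_.Topology

universe u

namespace Literature.Geometry.Manifold

variable {EM : Type u} [NormedAddCommGroup EM] [NormedSpace ℝ EM] [FiniteDimensional ℝ EM]
  {M : Type u} [TopologicalSpace M] [ChartedSpace EM M] [IsManifold 𝓘(ℝ, EM) ∞ M]
  [CompactSpace M] [T2Space M] [SecondCountableTopology M]
  {EP : Type u} [NormedAddCommGroup EP] [NormedSpace ℝ EP] [FiniteDimensional ℝ EP]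
  {P : Type u} [TopologicalSpace P] [ChartedSpace EP P] [IsManifold 𝓘(ℝ, EP) ∞ P]
  [CompactSpace P] [T2Space P] [SecondCountableTopology P]
  {f : P → M}

/-! ### The tautness datum of the image of a compact manifold -/

omit [IsManifold 𝓘(ℝ, EM) ∞ M] [SecondCountableTopology M] [IsManifold 𝓘(ℝ, EP) ∞ P]
  [SecondCountableTopology P] [T2Space P] [FiniteDimensional ℝ EP] [ChartedSpace EM M]
  [ChartedSpace EP P] [FiniteDimensional ℝ EM] in
/-- **The image of a compact manifold under an embedding into a compact manifold is taut**: it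
carries a tautness datum `Cech.RetractionNhds (range f)` (Spanier, Ch. 6 §1, Cor. 11: `M ↪ ℝᴺ`
is a neighbourhood retract by Hatcher's Cor. A.9, and so is the compact, locally contractible
`f(P) ≅ P` by Hatcher's Thm. A.7). The model spaces of the two manifolds are explicit arguments.
[cite: Spanier1981, Ch. 6 §1, Thm. 10] [cite: HatcherAT2002, Thm. A.7 and Cor. A.9] -/
theorem nonempty_retractionNhds_range (HM : Type*) [NormedAddCommGroup HM] [NormedSpace ℝ HM]
    [FiniteDimensional ℝ HM] [ChartedSpace HM M] (HP : Type*) [NormedAddCommGroup HP]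
    [NormedSpace ℝ HP] [ChartedSpace HP P] (hfe : IsEmbedding f) :
    Nonempty (Cech.RetractionNhds (Set.range f)) := by
  obtain ⟨N, ι, hι⟩ := exists_isClosedEmbedding_pi_of_compactSpace (M := M) HM
  have hNR : Literature.AlgebraicTopology.Homotopy.IsNeighbourhoodRetract (Set.range ι) :=
    Literature.AlgebraicTopology.Homotopy.isNeighbourhoodRetract_range_of_compactSpace
      Literature.AlgebraicTopology.Homotopy.isNeighbourhoodRetract_of_locallyContractibleSpace_holds
      HM hι.isEmbedding
  have hK : IsCompact (Set.range f) := isCompact_range hfe.continuous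
  have hLC : LocallyContractibleSpace (Set.range f) :=
    Literature.AlgebraicTopology.Homotopy.locallyContractibleSpace_of_homeomorph hfe.toHomeomorph
      (Literature.AlgebraicTopology.Homotopy.locallyContractibleSpace_of_chartedSpace HP)
  exact Cech.RetractionNhds.nonempty_of_locallyContractibleSpace hι.isEmbedding hNR hK hLC

/-! ### The pull-back to `P` of the cohomology of `K = f(P)` is bijective -/

/-- A map sends `univ` into its range. [folklore] -/
theorem mapsTo_univ_range {α β : Type*} {g : α → β} : MapsTo g (univ : Set α) (Set.range g) :=
  fun x _ ↦ ⟨x, rfl⟩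

omit [IsManifold 𝓘(ℝ, EM) ∞ M] [SecondCountableTopology M] [IsManifold 𝓘(ℝ, EP) ∞ P]
  [SecondCountableTopology P] [T2Space P] [FiniteDimensional ℝ EP] [CompactSpace M] [T2Space M]
  [FiniteDimensional ℝ EM] [CompactSpace P] in
/-- **`f* : H^p_M(f(P)) → H^p_P(P)` is bijective for an embedding `f`** (the restriction
`P ≅ f(P)` is a homeomorphism; `subsetCochains.pullH_bijective_iff`). [cite: HatcherAT2002, §2.1 p. 111] -/
theorem pullH_range_bijective (hfe : IsEmbedding f) (p : ℕ) :
    Function.Bijective (subsetCochains.pullH (N := realCoeff.{u}) ⟨f, hfe.continuous⟩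
      (mapsTo_univ_range (g := f)) p) := by
  rw [subsetCochains.pullH_bijective_iff]
  -- the restricted map `↥univ → ↥(range f)` is a homeomorphism
  let e : ↥(univ : Set P) ≃ₜ ↥(Set.range f) := (Homeomorph.Set.univ P).trans hfe.toHomeomorph
  have he : (subsetCochains.restrictMap ⟨f, hfe.continuous⟩ (mapsTo_univ_range (g := f)) :
      C(↥(univ : Set P), ↥(Set.range f))) = (e : C(↥(univ : Set P), ↥(Set.range f))) := by
    ext x
    rfl
  rw [he]
  exact ((forget (ModuleCat ℝ)).mapIso (singularCohomology.mapIso ℝ ℝ e p)).toEquiv.bijective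

/-! ### T1: a class dying on `P` dies on a neighbourhood of `f(P)` -/

/-- **T1 (classes).** Let `W ⊇ f(P)` be open and `y` a de Rham class of `W` (in the cohomology of
the tree's `localDeRhamComplex`) whose pull-back along `f` vanishes in the de Rham cohomology of
`P`. Then `y` vanishes on some open `V` with `f(P) ⊆ V ⊆ W`. Proof: transport to the cohomology of
subsets (`localDeRhamToSubset`, bijective; natural for `f`, `localDeRhamToSubset_pullbackInto_apply`,
and for restrictions); there `f^*` factors through the restriction to `K = f(P)` followed by the
bijection `H_M(K) ≅ H_P(P)` (`pullH_range_bijective`), so the restriction of the class to `K`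
vanishes, hence (tautness, `Cech.RetractionNhds.injective_toSubset`, `Cech.of_eq_zero_iff`) it
vanishes on a neighbourhood. [cite: Spanier1981, Ch. 6 §1, Thm. 10] [cite: Bredon1993, Thm. V.9.5] -/
theorem exists_nhd_homologyMap_res_eq_zero_of_pullback (hf : ContMDiff 𝓘(ℝ, EP) 𝓘(ℝ, EM) ∞ f)
    (hfe : IsEmbedding f) {W : Set M} (hW : IsOpen W) (hfW : ∀ y, f y ∈ W) (p : ℕ)
    (y : (localDeRhamComplex 𝓘(ℝ, EM) ℝ hW).homology p)
    (hy : HomologicalComplex.homologyMap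
      (localDeRhamComplex.pullbackInto 𝓘(ℝ, EP) hf hW hfW) p y = 0) :
    ∃ (V : Set M) (hV : IsOpen V) (hVW : V ⊆ W), Set.range f ⊆ V ∧
      HomologicalComplex.homologyMap (localDeRhamComplex.res 𝓘(ℝ, EM) ℝ hV hW hVW) p y = 0 := by
  have hKW : Set.range f ⊆ W := by rintro _ ⟨x, rfl⟩; exact hfW x
  obtain ⟨T⟩ := nonempty_retractionNhds_range (f := f) EM EP hfe
  -- the class in the cohomology of subsets and its pull-back to `P`
  have hpull : subsetCochains.pullH (N := realCoeff.{u}) ⟨f, hf.continuous⟩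
      (mapsTo_univ_of_forall_mem hfW) p (localDeRhamToSubset 𝓘(ℝ, EM) hW p y) = 0 := by
    rw [← localDeRhamToSubset_pullbackInto_apply hf hW hfW p y, hy, map_zero]
  -- factor through the restriction to `K = range f`
  have hfac : subsetCochains.pullH (N := realCoeff.{u}) ⟨f, hf.continuous⟩
      (mapsTo_univ_range (g := f)) p
        (subsetCochains.resH (N := realCoeff.{u}) hKW p (localDeRhamToSubset 𝓘(ℝ, EM) hW p y)) = 0 := by
    have hsq := subsetCochains.resH_comp_pullH (N := realCoeff.{u}) ⟨f, hf.continuous⟩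
      (subset_refl (univ : Set P)) hKW (mapsTo_univ_of_forall_mem hfW) (mapsTo_univ_range (g := f)) p
    have h1 := congrArg (fun φ ↦ φ (localDeRhamToSubset 𝓘(ℝ, EM) hW p y)) hsq
    dsimp only at h1
    rw [ModuleCat.comp_apply, ModuleCat.comp_apply, hpull, map_zero] at h1
    exact h1
  have hresK : subsetCochains.resH (N := realCoeff.{u}) hKW p (localDeRhamToSubset 𝓘(ℝ, EM) hW p y) = 0 :=
    (pullH_range_bijective hfe p).1 (by rw [hfac, map_zero])
  -- tautness: the Čech germ of the class vanishes, hence it vanishes on a smaller neighbourhood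
  have hgerm : Cech.of ℝ realCoeff.{u} (⟨W, hW, hKW⟩ : OpenNhd M (Set.range f))
      (localDeRhamToSubset 𝓘(ℝ, EM) hW p y) = 0 := by
    apply T.injective_toSubset p
    rw [Cech.toSubset_of, map_zero]
    exact hresK
  obtain ⟨V, hle, hV0⟩ := (Cech.of_eq_zero_iff _).1 hgerm
  refine ⟨V.carrier, V.isOpen, hle, V.subset, ?_⟩
  apply (localDeRhamToSubset_bijective (I := 𝓘(ℝ, EM)) V.isOpen p).1
  rw [map_zero, localDeRhamToSubset_res_apply V.isOpen hW hle p y]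
  exact hV0

/-- **T1, positive degree (forms).** A closed `(k+1)`-form `θ` on an open `W ⊇ f(P)` whose
pull-back along `f` is exact on `P` is exact on some open `V` with `f(P) ⊆ V ⊆ W`.
[cite: Spanier1981, Ch. 6 §1, Thm. 10] [cite: Bredon1993, Thm. V.9.5] -/
theorem exists_nhd_restr_mem_localExactForms_of_pullback_eq_mextDeriv
    (hf : ContMDiff 𝓘(ℝ, EP) 𝓘(ℝ, EM) ∞ f) (hfe : IsEmbedding f) {W : Set M} (hW : IsOpen W)
    (hfW : ∀ y, f y ∈ W) {k : ℕ} {θ : MForm 𝓘(ℝ, EM) M ℝ (k + 1)}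
    (hθ : θ ∈ localClosedForms 𝓘(ℝ, EM) ℝ (k + 1) W) {lam : MForm 𝓘(ℝ, EP) P ℝ k}
    (hlam : IsSmoothForm lam) (he : θ.pullback 𝓘(ℝ, EP) f = mextDeriv lam) :
    ∃ (V : Set M) (hV : IsOpen V), V ⊆ W ∧ Set.range f ⊆ V ∧
      θ.restr V ∈ localExactForms 𝓘(ℝ, EM) ℝ hV (k + 1) := by
  -- the cycle `θ` of `Ω•(W)` and its class
  let z : (localDeRhamComplex 𝓘(ℝ, EM) ℝ hW).X (k + 1) := ⟨θ, localClosedForms_le_smoothFormsOn hθ⟩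
  have hz0 : (localDeRhamComplex 𝓘(ℝ, EM) ℝ hW).d (k + 1) (k + 1 + 1) z = 0 :=
    (localDeRhamComplex_d_eq_zero_iff hW (k + 1) z).2 hθ
  have hz : (localDeRhamComplex 𝓘(ℝ, EM) ℝ hW).d (k + 1) ((ComplexShape.down ℕ).symm.next (k + 1)) z = 0 := by
    rw [cnext]; exact hz0
  -- its pull-back to `P` is the boundary of `lam`
  have hw : lam ∈ smoothFormsOn 𝓘(ℝ, EP) ℝ (univ : Set P) k := by
    rw [smoothFormsOn_univ]; exact hlam
  have hy : HomologicalComplex.homologyMap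
      (localDeRhamComplex.pullbackInto 𝓘(ℝ, EP) hf hW hfW) (k + 1) (homologyCls z hz) = 0 := by
    rw [homologyMap_homologyCls, homologyCls_eq_zero_iff]
    refine ⟨((localDeRhamComplex 𝓘(ℝ, EP) ℝ (isOpen_univ : IsOpen (univ : Set P))).XIsoOfEq
      (cprev k)).inv ⟨lam, hw⟩, ?_⟩
    rw [← ModuleCat.comp_apply, HomologicalComplex.XIsoOfEq_inv_comp_d, localDeRhamComplex_d_apply]
    apply Subtype.ext
    rw [localDeRhamComplex.pullbackInto_f_apply_coe, coe_localD, MForm.restr_univ]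
    exact he.symm
  obtain ⟨V, hV, hVW, hKV, hres⟩ :=
    exists_nhd_homologyMap_res_eq_zero_of_pullback hf hfe hW hfW (k + 1) (homologyCls z hz) hy
  refine ⟨V, hV, hVW, hKV, ?_⟩
  rw [homologyMap_homologyCls, homologyCls_eq_zero_iff] at hres
  obtain ⟨w, hw'⟩ := hres
  have hex := (localDeRhamComplex_exists_d_eq_iff hV k
    ((localDeRhamComplex.res 𝓘(ℝ, EM) ℝ hV hW hVW).f (k + 1) z)).1
    ⟨((localDeRhamComplex 𝓘(ℝ, EM) ℝ hV).XIsoOfEq (cprev k)).hom w, by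
      rw [← ModuleCat.comp_apply, HomologicalComplex.XIsoOfEq_hom_comp_d]; exact hw'⟩
  rw [localDeRhamComplex.res_f_apply, coe_restrictₗ] at hex
  exact hex

/-- **T1, degree `0` (forms).** A closed `0`-form (a locally constant function) on an open
`W ⊇ f(P)` vanishing on `f(P)` vanishes on some open `V` with `f(P) ⊆ V ⊆ W`.
[cite: Spanier1981, Ch. 6 §1, Thm. 10] -/
theorem exists_nhd_restr_eq_zero_of_pullback_eq_zero
    (hf : ContMDiff 𝓘(ℝ, EP) 𝓘(ℝ, EM) ∞ f) (hfe : IsEmbedding f) {W : Set M} (hW : IsOpen W)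
    (hfW : ∀ y, f y ∈ W) {θ : MForm 𝓘(ℝ, EM) M ℝ 0} (hθ : θ ∈ localClosedForms 𝓘(ℝ, EM) ℝ 0 W)
    (he : θ.pullback 𝓘(ℝ, EP) f = 0) :
    ∃ (V : Set M), IsOpen V ∧ V ⊆ W ∧ Set.range f ⊆ V ∧ θ.restr V = 0 := by
  let z : (localDeRhamComplex 𝓘(ℝ, EM) ℝ hW).X 0 := ⟨θ, localClosedForms_le_smoothFormsOn hθ⟩
  have hz0 : (localDeRhamComplex 𝓘(ℝ, EM) ℝ hW).d 0 (0 + 1) z = 0 :=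
    (localDeRhamComplex_d_eq_zero_iff hW 0 z).2 hθ
  have hz : (localDeRhamComplex 𝓘(ℝ, EM) ℝ hW).d 0 ((ComplexShape.down ℕ).symm.next 0) z = 0 := by
    rw [cnext]; exact hz0
  have hy : HomologicalComplex.homologyMap
      (localDeRhamComplex.pullbackInto 𝓘(ℝ, EP) hf hW hfW) 0 (homologyCls z hz) = 0 := by
    rw [homologyMap_homologyCls]
    have h0 : (localDeRhamComplex.pullbackInto 𝓘(ℝ, EP) hf hW hfW).f 0 z = 0 := by
      apply Subtype.ext
      rw [localDeRhamComplex.pullbackInto_f_apply_coe]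
      exact he
    rw [homologyCls_congr h0 _ (by rw [map_zero]), homologyCls_zero]
  obtain ⟨V, hV, hVW, hKV, hres⟩ :=
    exists_nhd_homologyMap_res_eq_zero_of_pullback hf hfe hW hfW 0 (homologyCls z hz) hy
  refine ⟨V, hV, hVW, hKV, ?_⟩
  rw [homologyMap_homologyCls, homologyCls_eq_zero_iff] at hres
  obtain ⟨w, hw'⟩ := hres
  -- in degree `0` there are no boundaries: `d_{prev 0, 0} = 0`
  have hshape : (localDeRhamComplex 𝓘(ℝ, EM) ℝ hV).d ((ComplexShape.down ℕ).symm.prev 0) 0 = 0 :=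
    (localDeRhamComplex 𝓘(ℝ, EM) ℝ hV).shape _ _ (by
      rw [cprev_zero]; change ¬ ((0 : ℕ) + 1 = 0); omega)
  rw [hshape] at hw'
  have h0 : (localDeRhamComplex.res 𝓘(ℝ, EM) ℝ hV hW hVW).f 0 z = 0 := by
    rw [← hw']; rfl
  have := congrArg (fun x ↦ (x.1 : MForm 𝓘(ℝ, EM) M ℝ 0)) h0
  simpa [localDeRhamComplex.res_f_apply, coe_restrictₗ] using this

/-! ### T2: classes on `P` extend to neighbourhoods of `f(P)` -/

/-- **T2 (classes).** Every de Rham class of `P` is the pull-back along `f` of a de Rham class on an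
open `V`, `f(P) ⊆ V ⊆ W`, for any given open `W ⊇ f(P)`. Proof: transport to the cohomology of
subsets; there the class of `P` corresponds to a class on `K = f(P)` (`pullH_range_bijective`),
which is the restriction of a class on a neighbourhood (tautness, `surjective_toSubset`,
`Cech.exists_of_le`), and `localDeRhamToSubset` is bijective on that neighbourhood.
[cite: Spanier1981, Ch. 6 §1, Thm. 10] [cite: Bredon1993, Thm. V.9.5] -/
theorem exists_nhd_homologyMap_pullbackInto_eq (hf : ContMDiff 𝓘(ℝ, EP) 𝓘(ℝ, EM) ∞ f)
    (hfe : IsEmbedding f) {W : Set M} (hW : IsOpen W) (hKW : Set.range f ⊆ W) (p : ℕ)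
    (yP : (localDeRhamComplex 𝓘(ℝ, EP) ℝ (isOpen_univ : IsOpen (univ : Set P))).homology p) :
    ∃ (V : Set M) (hV : IsOpen V) (_ : V ⊆ W) (hfV : ∀ x, f x ∈ V)
      (yV : (localDeRhamComplex 𝓘(ℝ, EM) ℝ hV).homology p),
      HomologicalComplex.homologyMap (localDeRhamComplex.pullbackInto 𝓘(ℝ, EP) hf hV hfV) p yV = yP := by
  obtain ⟨T⟩ := nonempty_retractionNhds_range (f := f) EM EP hfe
  -- the class on `K`
  obtain ⟨cK, hcK⟩ := (pullH_range_bijective hfe p).2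
    (localDeRhamToSubset 𝓘(ℝ, EP) (isOpen_univ : IsOpen (univ : Set P)) p yP)
  -- tautness: it is the restriction of a class on a neighbourhood inside `W`
  obtain ⟨g, hg⟩ := T.surjective_toSubset (R := ℝ) (N := realCoeff.{u}) p cK
  obtain ⟨U, hle, a, rfl⟩ := Cech.exists_of_le (⟨W, hW, hKW⟩ : OpenNhd M (Set.range f)) g
  rw [Cech.toSubset_of] at hg
  have hfU : ∀ x, f x ∈ U.carrier := fun x ↦ U.subset ⟨x, rfl⟩
  obtain ⟨yV, hyV⟩ := (localDeRhamToSubset_bijective (I := 𝓘(ℝ, EM)) U.isOpen p).2 a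
  refine ⟨U.carrier, U.isOpen, hle, hfU, yV, ?_⟩
  apply (localDeRhamToSubset_bijective (I := 𝓘(ℝ, EP)) (isOpen_univ : IsOpen (univ : Set P)) p).1
  rw [localDeRhamToSubset_pullbackInto_apply hf U.isOpen hfU p yV, hyV, ← hcK, ← hg]
  -- `pullH` along `f` from `U` factors through the restriction to `K`
  have hsq := subsetCochains.resH_comp_pullH (N := realCoeff.{u}) ⟨f, hf.continuous⟩
    (subset_refl (univ : Set P)) U.subset (mapsTo_univ_of_forall_mem hfU) (mapsTo_univ_range (g := f)) p
  have h1 := congrArg (fun φ ↦ φ a) hsq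
  dsimp only at h1
  rw [ModuleCat.comp_apply, ModuleCat.comp_apply] at h1
  rw [h1]
  change _ = (HomologicalComplex.homologyMap (subsetCochains.res ℝ realCoeff.{u}
    (subset_refl (univ : Set P))) p) _
  rw [subsetCochains.res_refl, HomologicalComplex.homologyMap_id]
  rfl

/-- **T2 (forms).** For every closed smooth `k`-form `lam` on `P` and open `W ⊇ f(P)` there are an
open `V` with `f(P) ⊆ V ⊆ W` and a closed `k`-form `ζ` on `V` whose pull-back along `f` differs
from `lam` by an exact form. [cite: Spanier1981, Ch. 6 §1, Thm. 10] [cite: Bredon1993, Thm. V.9.5] -/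
theorem exists_nhd_pullback_sub_mem_exactSmoothForms (hf : ContMDiff 𝓘(ℝ, EP) 𝓘(ℝ, EM) ∞ f)
    (hfe : IsEmbedding f) {W : Set M} (hW : IsOpen W) (hKW : Set.range f ⊆ W) {k : ℕ}
    {lam : MForm 𝓘(ℝ, EP) P ℝ k} (hlam : lam ∈ closedSmoothForms 𝓘(ℝ, EP) P ℝ k) :
    ∃ (V : Set M) (_ : IsOpen V), V ⊆ W ∧ Set.range f ⊆ V ∧
      ∃ ζ ∈ localClosedForms 𝓘(ℝ, EM) ℝ k V,
        ζ.pullback 𝓘(ℝ, EP) f - lam ∈ exactSmoothForms 𝓘(ℝ, EP) P ℝ k := by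
  have hlam' := mem_localClosedForms_univ_of_mem_closedSmoothForms hlam
  let zP : (localDeRhamComplex 𝓘(ℝ, EP) ℝ (isOpen_univ : IsOpen (univ : Set P))).X k :=
    ⟨lam, localClosedForms_le_smoothFormsOn hlam'⟩
  have hzP0 : (localDeRhamComplex 𝓘(ℝ, EP) ℝ (isOpen_univ : IsOpen (univ : Set P))).d k (k + 1) zP = 0 :=
    (localDeRhamComplex_d_eq_zero_iff _ k zP).2 hlam'
  have hzP : (localDeRhamComplex 𝓘(ℝ, EP) ℝ (isOpen_univ : IsOpen (univ : Set P))).d k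
      ((ComplexShape.down ℕ).symm.next k) zP = 0 := by
    rw [cnext]; exact hzP0
  obtain ⟨V, hV, hVW, hfV, yV, hyV⟩ :=
    exists_nhd_homologyMap_pullbackInto_eq hf hfe hW hKW k (homologyCls zP hzP)
  obtain ⟨zV, hzV, rfl⟩ := homologyCls_surjective yV
  have hzV0 : (localDeRhamComplex 𝓘(ℝ, EM) ℝ hV).d k (k + 1) zV = 0 := by
    have := hzV; rwa [cnext] at this
  have hζ : (zV.1 : MForm 𝓘(ℝ, EM) M ℝ k) ∈ localClosedForms 𝓘(ℝ, EM) ℝ k V :=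
    (localDeRhamComplex_d_eq_zero_iff hV k zV).1 hzV0
  refine ⟨V, hV, hVW, fun _ ⟨x, hx⟩ ↦ hx ▸ hfV x, zV.1, hζ, ?_⟩
  rw [homologyMap_homologyCls, homologyCls_eq_homologyCls_iff] at hyV
  obtain ⟨w, hw⟩ := hyV
  have hdiff : (((localDeRhamComplex.pullbackInto 𝓘(ℝ, EP) hf hV hfV).f k zV - zP :
      (localDeRhamComplex 𝓘(ℝ, EP) ℝ (isOpen_univ : IsOpen (univ : Set P))).X k).1 :
        MForm 𝓘(ℝ, EP) P ℝ k) = (zV.1 : MForm 𝓘(ℝ, EM) M ℝ k).pullback 𝓘(ℝ, EP) f - lam := rfl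
  cases k with
  | zero =>
    -- no boundaries in degree `0`
    have hshape : (localDeRhamComplex 𝓘(ℝ, EP) ℝ (isOpen_univ : IsOpen (univ : Set P))).d
        ((ComplexShape.down ℕ).symm.prev 0) 0 = 0 :=
      (localDeRhamComplex 𝓘(ℝ, EP) ℝ _).shape _ _ (by
        rw [cprev_zero]; change ¬ ((0 : ℕ) + 1 = 0); omega)
    rw [hshape] at hw
    have h0 : (zV.1 : MForm 𝓘(ℝ, EM) M ℝ 0).pullback 𝓘(ℝ, EP) f - lam = 0 := by
      rw [← hdiff, ← hw]; rfl
    rw [h0]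
    exact Submodule.zero_mem _
  | succ k =>
    apply mem_exactSmoothForms_of_mem_localExactForms_univ
    rw [← hdiff]
    apply (localDeRhamComplex_exists_d_eq_iff _ k _).1
    exact ⟨((localDeRhamComplex 𝓘(ℝ, EP) ℝ (isOpen_univ : IsOpen (univ : Set P))).XIsoOfEq
      (cprev k)).hom w, by rw [← ModuleCat.comp_apply, HomologicalComplex.XIsoOfEq_hom_comp_d]; exact hw⟩

end Literature.Geometry.Manifold
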